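import Literature.Probability.LatticeModels.GinibreBesselBounds
import Literature.Analysis.FunctionSpaces.BesselJAnalyticProofs
import HarnessLib

/-!
# Order ball for the twisted Bessel row: `|Σ_{j>J} 2 iʲ J_j(y) I_{jm}(v)| ≤ 2 I_{(J+1)m}(v) Σ_{j>J} |J_j(y)|`

Reproduction-side support lemma for the simple-random-walk integrals of Fitzner–van der Hofstad
[FitznerVanDerHofstad2016NoBLE, (3.34)–(3.36) p. 1071; §5.1.1 (5.2)–(5.4)] at an axis node.  The
twisted one-coordinate transform `B_m(v,y) = ∫_{-π}^{π} e^{v cos t + iy cos(mt)} dt` is the folded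
Bessel row `2π (I_0(v) J_0(y) + 2 Σ_{j ≥ 1} iʲ J_j(y) I_{jm}(v))` ([DLMF, 10.35.2, 10.12.3];
`SrwTwistBesselRow.lean`).  A kernel tabulates the row only up to an order `J`; this file bounds what
is dropped — the ORDER BALL — using two monotonicity facts already in the tree:

* `I_a(v)` is non-negative and antitone in `|a|` for `v ≥ 0`
  (`Literature.Probability.LatticeModels.besselI_le_of_natAbs_le`, [Watson1944, §3.71]);
* `|J_n(y)| ≤ |y/2|ⁿ/n! · e^{|y/2|²}` (`Literature.Analysis.FunctionSpaces.abs_besselJ_le_pow_div_factorial`,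
  [DLMF, 10.14.4]).

Main statements (`m : ℤ`, `J : ℕ`, `0 ≤ v`; the tail term is
`T_k = 2 · I_{(k+J+1)m}(v) · 2π i^{k+J+1} J_{k+J+1}(y)`, i.e. the `j = k+J+1 ≥ 1` terms of the folded row):

* `summable_besselRowTail`, `norm_tsum_besselRowTail_le` — the ORDER BALL
  `‖Σ_k T_k‖ ≤ 4π · I_{(J+1)m}(v) · Σ_k |J_{k+J+1}(y)|`;
* `tsum_abs_besselJ_tail_le` — the Bessel-`J` order tail
  `Σ_k |J_{k+J+1}(y)| ≤ |y/2|^{J+1}/(J+1)! · e^{|y/2|² + |y/2|}`, and `…_of_abs_le_one`: for `|y| ≤ 1`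
  the factor `e^{|y/2|²+|y/2|} ≤ 17/8`;
* `norm_tsum_besselRowTail_le_closed` — the two combined; `norm_sub_sum_range_le_of_hasSum_besselRow`
  (+ `_closed_`) — the TRUNCATION form `‖B − Σ_{j ≤ J} ε_j I_{jm}(v)·2π iʲ J_j(y)‖ ≤ ball` for any `B`
  that is the sum of the folded row (hypothesis `HasSum`; for `B = B_m(v,y)` it is
  `hasSum_besselRow_nat_μI` of `SrwTwistBesselRow.lean`, which this file deliberately does not import);
* `norm_add_pow_sub_pow_le`, `abs_re_add_pow_sub_re_pow_le` — the power-perturbation step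
  `‖(a + r)^d − a^d‖ ≤ (‖a‖ + ‖r‖)^d − ‖a‖^d` that carries a per-coordinate ball through the `d`-th
  power of the row.

Everything is PROVED (standard axioms); no definition, no named fact, no numeral table; `d`-free.
Epistemic status / lane: what-if / input-certification SUPPORT (the truncation half of the soundness
of a twisted-seed kernel certificate); nothing here is a certificate and no statement at a specific
dimension is made.

## References

* R. Fitzner, R. van der Hofstad, *Generalized approach to the non-backtracking lace expansion*,
  PTRF 169 (2017) 1041–1119, (3.34)–(3.36) p. 1071, §5.1.1 (5.2)–(5.4). [FitznerVanDerHofstad2016NoBLE]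
* NIST DLMF §10.12.3, §10.14.4 (`|J_ν(z)| ≤ |z/2|^ν e^{|Im z|}/Γ(ν+1)`-type bounds), §10.35.2, §10.37
  (monotonicity of `I_ν` in the order). [DLMF]
* G. N. Watson, *A Treatise on the Theory of Bessel Functions*, 2nd ed. (CUP 1944), §2.11, §3.71. [Watson1944]
-/

noncomputable section

open scoped Nat Topology
open Real

namespace Literature.Probability.FitznerVanDerHofstad2017

open Literature.Probability.LatticeModels (besselI besselI_nonneg besselI_le_of_natAbs_le)
open Literature.Analysis.FunctionSpaces (besselJ abs_besselJ_le_pow_div_factorial)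

/-! ### 1. The Bessel-`J` order tail -/
section JTail

/-- Termwise: `|J_{k+J+1}(y)| ≤ e^{|y/2|²} |y/2|^{J+1}/(J+1)! · |y/2|^k/k!`
(`(J+1)!·k! ≤ (k+J+1)!`). [cite: DLMF, 10.14.4] -/
theorem abs_besselJ_add_le (J k : ℕ) (y : ℝ) :
    |besselJ (k + J + 1) y|
      ≤ Real.exp (|y / 2| ^ 2) * (|y / 2| ^ (J + 1) / (J + 1)!) * (|y / 2| ^ k / k !) := by
  have h := abs_besselJ_le_pow_div_factorial (k + J + 1) y
  have hs : 0 ≤ |y / 2| := abs_nonneg _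
  have hfac : ((J + 1)! : ℝ) * k ! ≤ ((k + J + 1)! : ℝ) := by
    have := Nat.le_of_dvd (Nat.factorial_pos _) (Nat.factorial_mul_factorial_dvd_factorial_add (J + 1) k)
    rw [show J + 1 + k = k + J + 1 by ring] at this
    exact_mod_cast this
  have hJpos : (0:ℝ) < (J + 1)! := by positivity
  have hkpos : (0:ℝ) < k ! := by positivity
  calc |besselJ (k + J + 1) y|
      ≤ |y / 2| ^ (k + J + 1) / (k + J + 1)! * Real.exp (|y / 2| ^ 2) := h
    _ ≤ |y / 2| ^ (k + J + 1) / (((J + 1)! : ℝ) * k !) * Real.exp (|y / 2| ^ 2) := by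
        gcongr
    _ = Real.exp (|y / 2| ^ 2) * (|y / 2| ^ (J + 1) / (J + 1)!) * (|y / 2| ^ k / k !) := by
        rw [show k + J + 1 = (J + 1) + k by ring, pow_add]
        field_simp

/-- The order tail of `|J_n(y)|` is summable. [cite: DLMF, 10.14.4] -/
theorem summable_abs_besselJ_tail (J : ℕ) (y : ℝ) :
    Summable fun k : ℕ => |besselJ (k + J + 1) y| := by
  refine Summable.of_nonneg_of_le (fun k => abs_nonneg _) (fun k => abs_besselJ_add_le J k y) ?_
  exact (Real.summable_pow_div_factorial _).mul_left _

/-- **Bessel-`J` order tail**: `Σ_{k ≥ 0} |J_{k+J+1}(y)| ≤ |y/2|^{J+1}/(J+1)! · e^{|y/2|² + |y/2|}`.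
[cite: DLMF, 10.14.4] -/
theorem tsum_abs_besselJ_tail_le (J : ℕ) (y : ℝ) :
    ∑' k : ℕ, |besselJ (k + J + 1) y|
      ≤ |y / 2| ^ (J + 1) / (J + 1)! * Real.exp (|y / 2| ^ 2 + |y / 2|) := by
  have hexp : HasSum (fun k : ℕ => |y / 2| ^ k / k !) (Real.exp |y / 2|) := by
    rw [Real.exp_eq_exp_ℝ]
    exact NormedSpace.expSeries_div_hasSum_exp (|y / 2| : ℝ)
  have hmaj : HasSum (fun k : ℕ => Real.exp (|y / 2| ^ 2) * (|y / 2| ^ (J + 1) / (J + 1)!)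
      * (|y / 2| ^ k / k !)) (Real.exp (|y / 2| ^ 2) * (|y / 2| ^ (J + 1) / (J + 1)!) * Real.exp |y / 2|) :=
    hexp.mul_left _
  calc ∑' k : ℕ, |besselJ (k + J + 1) y|
      ≤ ∑' k : ℕ, Real.exp (|y / 2| ^ 2) * (|y / 2| ^ (J + 1) / (J + 1)!) * (|y / 2| ^ k / k !) :=
        (summable_abs_besselJ_tail J y).tsum_le_tsum (fun k => abs_besselJ_add_le J k y) hmaj.summable
    _ = Real.exp (|y / 2| ^ 2) * (|y / 2| ^ (J + 1) / (J + 1)!) * Real.exp |y / 2| := hmaj.tsum_eq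
    _ = |y / 2| ^ (J + 1) / (J + 1)! * Real.exp (|y / 2| ^ 2 + |y / 2|) := by
        rw [Real.exp_add]; ring

/-- Rational form for `|y| ≤ 1`: `e^{|y/2|²+|y/2|} ≤ e^{3/4} ≤ 17/8`, so
`Σ_{k ≥ 0} |J_{k+J+1}(y)| ≤ (17/8) · |y/2|^{J+1}/(J+1)!`. [cite: DLMF, 10.14.4] -/
theorem tsum_abs_besselJ_tail_le_of_abs_le_one (J : ℕ) {y : ℝ} (hy : |y| ≤ 1) :
    ∑' k : ℕ, |besselJ (k + J + 1) y| ≤ 17 / 8 * (|y / 2| ^ (J + 1) / (J + 1)!) := by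
  have hs : |y / 2| ≤ 1 / 2 := by rw [abs_div, abs_two]; linarith
  have hs0 : 0 ≤ |y / 2| := abs_nonneg _
  have h34 : |y / 2| ^ 2 + |y / 2| ≤ 3 / 4 := by nlinarith
  have hexp : Real.exp (|y / 2| ^ 2 + |y / 2|) ≤ 17 / 8 := by
    refine (Real.exp_le_exp.2 h34).trans ?_
    have hb := Real.exp_bound' (by norm_num : (0:ℝ) ≤ 3 / 4) (by norm_num : (3:ℝ) / 4 ≤ 1)
      (by norm_num : 0 < 5)
    refine hb.trans ?_
    simp only [Finset.sum_range_succ, Finset.sum_range_zero, Nat.factorial]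
    norm_num
  calc ∑' k : ℕ, |besselJ (k + J + 1) y|
      ≤ |y / 2| ^ (J + 1) / (J + 1)! * Real.exp (|y / 2| ^ 2 + |y / 2|) := tsum_abs_besselJ_tail_le J y
    _ ≤ |y / 2| ^ (J + 1) / (J + 1)! * (17 / 8) := by gcongr
    _ = 17 / 8 * (|y / 2| ^ (J + 1) / (J + 1)!) := by ring

end JTail

/-! ### 2. The order ball of the folded row -/
section OrderBall

/-- Termwise size of the row tail for `v ≥ 0`:
`‖2 I_{(k+J+1)m}(v) · 2π i^{k+J+1} J_{k+J+1}(y)‖ ≤ 4π I_{(J+1)m}(v) |J_{k+J+1}(y)|`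
(`I_a(v) ≥ 0` antitone in `|a|`). [cite: Watson1944, §3.71; DLMF, 10.37] -/
theorem norm_besselRowTail_term_le {v : ℝ} (hv : 0 ≤ v) (y : ℝ) (m : ℤ) (J k : ℕ) :
    ‖(2 : ℂ) * ((besselI (((k + J + 1 : ℕ) : ℤ) * m) v : ℂ)
        * (2 * π * Complex.I ^ (k + J + 1) * (besselJ (k + J + 1) y : ℂ)))‖
      ≤ 4 * π * besselI (((J + 1 : ℕ) : ℤ) * m) v * |besselJ (k + J + 1) y| := by
  have hI0 : 0 ≤ besselI (((k + J + 1 : ℕ) : ℤ) * m) v := besselI_nonneg hv _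
  have hmono : besselI (((k + J + 1 : ℕ) : ℤ) * m) v ≤ besselI (((J + 1 : ℕ) : ℤ) * m) v := by
    refine besselI_le_of_natAbs_le hv ?_
    rw [Int.natAbs_mul, Int.natAbs_mul, Int.natAbs_natCast, Int.natAbs_natCast]
    exact Nat.mul_le_mul_right _ (by omega)
  rw [norm_mul, norm_mul, norm_mul, norm_mul, norm_pow, Complex.norm_I, one_pow, mul_one,
    Complex.norm_real, Complex.norm_real, Real.norm_eq_abs, Real.norm_eq_abs, abs_of_nonneg hI0,
    norm_mul, Complex.norm_real, Real.norm_eq_abs, abs_of_pos Real.pi_pos, Complex.norm_ofNat]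
  have hJ0 : 0 ≤ |besselJ (k + J + 1) y| := abs_nonneg _
  nlinarith [Real.pi_pos, mul_le_mul_of_nonneg_right hmono hJ0]

/-- The row tail is absolutely summable (`v ≥ 0`). [cite: DLMF, 10.35.2; DLMF, 10.14.4] -/
theorem summable_norm_besselRowTail {v : ℝ} (hv : 0 ≤ v) (y : ℝ) (m : ℤ) (J : ℕ) :
    Summable fun k : ℕ => ‖(2 : ℂ) * ((besselI (((k + J + 1 : ℕ) : ℤ) * m) v : ℂ)
        * (2 * π * Complex.I ^ (k + J + 1) * (besselJ (k + J + 1) y : ℂ)))‖ :=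
  Summable.of_nonneg_of_le (fun _ => norm_nonneg _) (fun k => norm_besselRowTail_term_le hv y m J k)
    ((summable_abs_besselJ_tail J y).mul_left _)

/-- The row tail is summable (`v ≥ 0`). [cite: DLMF, 10.35.2; DLMF, 10.14.4] -/
theorem summable_besselRowTail {v : ℝ} (hv : 0 ≤ v) (y : ℝ) (m : ℤ) (J : ℕ) :
    Summable fun k : ℕ => (2 : ℂ) * ((besselI (((k + J + 1 : ℕ) : ℤ) * m) v : ℂ)
        * (2 * π * Complex.I ^ (k + J + 1) * (besselJ (k + J + 1) y : ℂ))) :=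
  (summable_norm_besselRowTail hv y m J).of_norm

/-- **ORDER BALL.** For `v ≥ 0`, every `m : ℤ` and every truncation order `J`,
`‖Σ_{k ≥ 0} 2 I_{(k+J+1)m}(v) · 2π i^{k+J+1} J_{k+J+1}(y)‖ ≤ 4π · I_{(J+1)m}(v) · Σ_{k ≥ 0} |J_{k+J+1}(y)|`:
what a kernel drops when it tabulates the folded row `2π(I_0 J_0 + 2Σ_{j≥1} iʲ J_j I_{jm})` only up to
`j ≤ J` is within `δ_J(y) := 2 Σ_{j>J} |J_j(y)|` times `2π I_{(J+1)m}(v)`.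
[cite: DLMF, 10.35.2; DLMF, 10.37; Watson1944, §3.71] -/
theorem norm_tsum_besselRowTail_le {v : ℝ} (hv : 0 ≤ v) (y : ℝ) (m : ℤ) (J : ℕ) :
    ‖∑' k : ℕ, (2 : ℂ) * ((besselI (((k + J + 1 : ℕ) : ℤ) * m) v : ℂ)
        * (2 * π * Complex.I ^ (k + J + 1) * (besselJ (k + J + 1) y : ℂ)))‖
      ≤ 4 * π * besselI (((J + 1 : ℕ) : ℤ) * m) v * ∑' k : ℕ, |besselJ (k + J + 1) y| := by
  refine (norm_tsum_le_tsum_norm (summable_norm_besselRowTail hv y m J)).trans ?_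
  rw [← tsum_mul_left]
  exact (summable_norm_besselRowTail hv y m J).tsum_le_tsum
    (fun k => norm_besselRowTail_term_le hv y m J k) ((summable_abs_besselJ_tail J y).mul_left _)

/-- **Order ball, closed form**: for `v ≥ 0`,
`‖Σ_{k ≥ 0} 2 I_{(k+J+1)m}(v) · 2π i^{k+J+1} J_{k+J+1}(y)‖
   ≤ 4π I_{(J+1)m}(v) · |y/2|^{J+1}/(J+1)! · e^{|y/2|²+|y/2|}`.
[cite: DLMF, 10.35.2; DLMF, 10.14.4; Watson1944, §3.71] -/
theorem norm_tsum_besselRowTail_le_closed {v : ℝ} (hv : 0 ≤ v) (y : ℝ) (m : ℤ) (J : ℕ) :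
    ‖∑' k : ℕ, (2 : ℂ) * ((besselI (((k + J + 1 : ℕ) : ℤ) * m) v : ℂ)
        * (2 * π * Complex.I ^ (k + J + 1) * (besselJ (k + J + 1) y : ℂ)))‖
      ≤ 4 * π * besselI (((J + 1 : ℕ) : ℤ) * m) v
          * (|y / 2| ^ (J + 1) / (J + 1)! * Real.exp (|y / 2| ^ 2 + |y / 2|)) := by
  have hI : 0 ≤ 4 * π * besselI (((J + 1 : ℕ) : ℤ) * m) v := by
    have := besselI_nonneg hv (((J + 1 : ℕ) : ℤ) * m); positivity
  exact (norm_tsum_besselRowTail_le hv y m J).trans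
    (mul_le_mul_of_nonneg_left (tsum_abs_besselJ_tail_le J y) hI)

/-- **Order ball, rational form for `|y| ≤ 1`**:
`‖tail‖ ≤ (17/2) π · I_{(J+1)m}(v) · |y/2|^{J+1}/(J+1)!`. [cite: DLMF, 10.35.2; DLMF, 10.14.4] -/
theorem norm_tsum_besselRowTail_le_of_abs_le_one {v : ℝ} (hv : 0 ≤ v) {y : ℝ} (hy : |y| ≤ 1)
    (m : ℤ) (J : ℕ) :
    ‖∑' k : ℕ, (2 : ℂ) * ((besselI (((k + J + 1 : ℕ) : ℤ) * m) v : ℂ)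
        * (2 * π * Complex.I ^ (k + J + 1) * (besselJ (k + J + 1) y : ℂ)))‖
      ≤ 17 / 2 * π * besselI (((J + 1 : ℕ) : ℤ) * m) v * (|y / 2| ^ (J + 1) / (J + 1)!) := by
  have hI : 0 ≤ 4 * π * besselI (((J + 1 : ℕ) : ℤ) * m) v := by
    have := besselI_nonneg hv (((J + 1 : ℕ) : ℤ) * m); positivity
  refine (norm_tsum_besselRowTail_le hv y m J).trans ?_
  refine (mul_le_mul_of_nonneg_left (tsum_abs_besselJ_tail_le_of_abs_le_one J hy) hI).trans_eq ?_
  ring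

/-- **Truncation of the folded row.** If `B` is the sum of the folded Bessel row
`Σ_{j ≥ 0} ε_j I_{jm}(v) · 2π iʲ J_j(y)` (`ε_0 = 1`, `ε_j = 2`; for `B = B_m(v,y)` this is
`hasSum_besselRow_nat_μI` of `SrwTwistBesselRow.lean`), then for `v ≥ 0` and every order `J`
`‖B − Σ_{j ≤ J} ε_j I_{jm}(v) · 2π iʲ J_j(y)‖ ≤ 4π I_{(J+1)m}(v) Σ_{k ≥ 0} |J_{k+J+1}(y)|`.
[cite: DLMF, 10.35.2; DLMF, 10.12.3; Watson1944, §3.71] -/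
theorem norm_sub_sum_range_le_of_hasSum_besselRow {v : ℝ} (hv : 0 ≤ v) (y : ℝ) (m : ℤ) (J : ℕ)
    {B : ℂ} (hB : HasSum (fun j : ℕ => (if j = 0 then (1 : ℂ) else 2)
        * ((besselI (j * m) v : ℂ) * (2 * π * Complex.I ^ j * (besselJ j y : ℂ)))) B) :
    ‖B - ∑ j ∈ Finset.range (J + 1), (if j = 0 then (1 : ℂ) else 2)
        * ((besselI (j * m) v : ℂ) * (2 * π * Complex.I ^ j * (besselJ j y : ℂ)))‖
      ≤ 4 * π * besselI (((J + 1 : ℕ) : ℤ) * m) v * ∑' k : ℕ, |besselJ (k + J + 1) y| := by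
  have htail := (hasSum_nat_add_iff' (J + 1)).2 hB
  have hfun : (fun k : ℕ => (if k + (J + 1) = 0 then (1 : ℂ) else 2)
      * ((besselI (((k + (J + 1) : ℕ) : ℤ) * m) v : ℂ)
        * (2 * π * Complex.I ^ (k + (J + 1)) * (besselJ (k + (J + 1)) y : ℂ))))
      = fun k : ℕ => (2 : ℂ) * ((besselI (((k + J + 1 : ℕ) : ℤ) * m) v : ℂ)
        * (2 * π * Complex.I ^ (k + J + 1) * (besselJ (k + J + 1) y : ℂ))) := by
    funext k
    rw [if_neg (by omega : k + (J + 1) ≠ 0), ← Nat.add_assoc]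
  rw [hfun] at htail
  rw [← htail.tsum_eq]
  exact norm_tsum_besselRowTail_le hv y m J

/-- The same with the closed-form ball:
`‖B − Σ_{j ≤ J} …‖ ≤ 4π I_{(J+1)m}(v) · |y/2|^{J+1}/(J+1)! · e^{|y/2|²+|y/2|}`.
[cite: DLMF, 10.35.2; DLMF, 10.14.4; Watson1944, §3.71] -/
theorem norm_sub_sum_range_le_closed_of_hasSum_besselRow {v : ℝ} (hv : 0 ≤ v) (y : ℝ) (m : ℤ)
    (J : ℕ) {B : ℂ} (hB : HasSum (fun j : ℕ => (if j = 0 then (1 : ℂ) else 2)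
        * ((besselI (j * m) v : ℂ) * (2 * π * Complex.I ^ j * (besselJ j y : ℂ)))) B) :
    ‖B - ∑ j ∈ Finset.range (J + 1), (if j = 0 then (1 : ℂ) else 2)
        * ((besselI (j * m) v : ℂ) * (2 * π * Complex.I ^ j * (besselJ j y : ℂ)))‖
      ≤ 4 * π * besselI (((J + 1 : ℕ) : ℤ) * m) v
          * (|y / 2| ^ (J + 1) / (J + 1)! * Real.exp (|y / 2| ^ 2 + |y / 2|)) := by
  have hI : 0 ≤ 4 * π * besselI (((J + 1 : ℕ) : ℤ) * m) v := by
    have := besselI_nonneg hv (((J + 1 : ℕ) : ℤ) * m); positivity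
  exact (norm_sub_sum_range_le_of_hasSum_besselRow hv y m J hB).trans
    (mul_le_mul_of_nonneg_left (tsum_abs_besselJ_tail_le J y) hI)

end OrderBall

/-! ### 3. Carrying a per-coordinate ball through the `d`-th power -/
section PowerPerturbation

/-- **Power perturbation**: `‖(a + r)^d − a^d‖ ≤ (‖a‖ + ‖r‖)^d − ‖a‖^d` for `a r : ℂ` and every `d`
(induction: `(a+r)^{d+1} − a^{d+1} = (a+r)((a+r)^d − a^d) + r a^d`) — the error bookkeeping of a
truncated coordinate factor inside the `d`-fold product of [FvdH17, §5.1.1].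
[cite: FitznerVanDerHofstad2016NoBLE, §5.1.1 (5.2)–(5.4)] -/
theorem norm_add_pow_sub_pow_le (a r : ℂ) (d : ℕ) :
    ‖(a + r) ^ d - a ^ d‖ ≤ (‖a‖ + ‖r‖) ^ d - ‖a‖ ^ d := by
  induction d with
  | zero => simp
  | succ d ih =>
    have key : (a + r) ^ (d + 1) - a ^ (d + 1) = (a + r) * ((a + r) ^ d - a ^ d) + r * a ^ d := by
      ring
    rw [key]
    have h1 : ‖(a + r) * ((a + r) ^ d - a ^ d)‖ ≤ (‖a‖ + ‖r‖) * ((‖a‖ + ‖r‖) ^ d - ‖a‖ ^ d) := by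
      rw [norm_mul]
      exact mul_le_mul (norm_add_le a r) ih (norm_nonneg _) (by positivity)
    have h2 : ‖r * a ^ d‖ = ‖r‖ * ‖a‖ ^ d := by rw [norm_mul, norm_pow]
    calc ‖(a + r) * ((a + r) ^ d - a ^ d) + r * a ^ d‖
        ≤ ‖(a + r) * ((a + r) ^ d - a ^ d)‖ + ‖r * a ^ d‖ := norm_add_le _ _
      _ ≤ (‖a‖ + ‖r‖) * ((‖a‖ + ‖r‖) ^ d - ‖a‖ ^ d) + ‖r‖ * ‖a‖ ^ d := by rw [h2]; linarith
      _ = (‖a‖ + ‖r‖) ^ (d + 1) - ‖a‖ ^ (d + 1) := by ring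

/-- Real-part form: `|Re (a + r)^d − Re a^d| ≤ (‖a‖ + ‖r‖)^d − ‖a‖^d`.
[cite: FitznerVanDerHofstad2016NoBLE, §5.1.1 (5.2)–(5.4)] -/
theorem abs_re_add_pow_sub_re_pow_le (a r : ℂ) (d : ℕ) :
    |((a + r) ^ d).re - (a ^ d).re| ≤ (‖a‖ + ‖r‖) ^ d - ‖a‖ ^ d := by
  rw [← Complex.sub_re]
  exact (Complex.abs_re_le_norm _).trans (norm_add_pow_sub_pow_le a r d)

/-- With a bound `‖r‖ ≤ ρ` on the ball: `|Re (a + r)^d − Re a^d| ≤ (‖a‖ + ρ)^d − ‖a‖^d`.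
[cite: FitznerVanDerHofstad2016NoBLE, §5.1.1 (5.2)–(5.4)] -/
theorem abs_re_add_pow_sub_re_pow_le_of_norm_le (a r : ℂ) {ρ : ℝ} (hr : ‖r‖ ≤ ρ) (d : ℕ) :
    |((a + r) ^ d).re - (a ^ d).re| ≤ (‖a‖ + ρ) ^ d - ‖a‖ ^ d := by
  refine (abs_re_add_pow_sub_re_pow_le a r d).trans ?_
  have : (‖a‖ + ‖r‖) ^ d ≤ (‖a‖ + ρ) ^ d :=
    pow_le_pow_left₀ (by positivity) (by linarith) d
  linarith

end PowerPerturbation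

end Literature.Probability.FitznerVanDerHofstad2017

end
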